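/-
Copyright (c) 2026 the pub-hodgecm-mathlib formalisation cell (harness21).  Prover seat hodgecm-mathlib-K2Liu-p11 (g0), Track B «K2-LIT»,
#184♮ = hLiu418 = `stmt-HodgeConjecture-24832`; LEAD F0P6-plan (g13) RULINGS M-157f/M-157g «(A∞-B)», junction lemma by name.
File (A∞-B), FILE 2 of 2: the scalar `c_k(s)` of the local intertwining operator of `U(2,2)` at a complex place on the `K`-type `det^{−k}`.
THEOREMS ONLY.
-/
import Summits.HodgeConjecture.HodgeConjecture.Theorems.K2LiuHermTwoXiZeroValue        -- ★ (this seat) FILE 1: `xiTwo_zero_right`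
import Summits.HodgeConjecture.HodgeConjecture.Theorems.K2LiuArchInducedTubeSection   -- ★ (this seat) (A∞-0b): `archIntertwining_archScalarSection_one`
import Mathlib.MeasureTheory.Measure.Lebesgue.Complex                                  -- `Complex.volume_preserving_equiv_real_prod`
import Mathlib.MeasureTheory.Measure.Lebesgue.EqHaar                                   -- `map_linearMap_addHaar_eq_smul_addHaar`
import Mathlib.LinearAlgebra.Complex.Determinant
import HarnessLib

/-!
# Crux `HLiu418`, A∞ organ, (A∞-B) FILE 2: `M_w(s) f⁰_{s,k}(1) = c_k(s)` — the scalar `K`-type of `U(2,2)` at a complex place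

Cell `hodgecm-mathlib`, crux item hLiu418 = `stmt-HodgeConjecture-24832` (helper lane `--supports`, count-neutral).

★ (A∞-0b) `archIntertwining_archScalarSection_one`: `M_w(s) f⁰_{s,k}(1) = ∫_{r} det(X+i)^{−k} |det(X+i)|^{k−2s−2} dr`, `X = hermOfReal r`,
`r : Fin 2 → Fin 2 → ℝ` (Lebesgue).  This file identifies it with Shimura's `ξ(1, 0; s+1+k/2, s+1−k/2)` (★ `xiTwo`, chart `hermTwo` on
`ℝ × ℂ × ℝ`) and reads off the value from ★ FILE 1:
* §1 `integrand_eq` — POINTWISE `det(X+i)^{−k}·|det(X+i)|^{k−2s−2} = xiTwoIntegrand 1 0 (s+1+k/2) (s+1−k/2) c` for `X = hermTwo c`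
  (the principal branches agree: `det(1 − iX) ∈ ℂ ∖ (−∞, 0]`, `det(1 + iX) = conj det(1 − iX)`, `det(X + i) = −det(1 − iX)`);
* §2 `integral_hermOfReal_eq` — the ONE Jacobian constant: `∫ F(hermOfReal r) dr = (1/8) · ∫ F(hermTwo c) dc` (a volume-preserving
  reshuffle `(Fin 2 → Fin 2 → ℝ) ≃ᵐ ℝ × ℂ × ℝ`, `exists_shuffle`, + the linear map `(a, z, b) ↦ (2a, (re z + im z) + (re z − im z) i, 2b)`
  of determinant `−8`, `exists_stretch`; no new definitions);
* §3 `archIntertwining_archScalarSection_one_eq_xiTwo` and the VALUE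
  `archIntertwining_archScalarSection_one_eq (k : ℤ) (hs : 1/2 < re s) :
     M_w(s) f⁰_{s,k}(1) = (1/8)·4π⁴·e^{−iπk}·Γ₂(s+1+k/2)⁻¹·Γ₂(s+1−k/2)⁻¹·(Γ₂(2s)·4^{−2s})`
  on the WHOLE half-plane of absolute convergence `re s > ½` (`Γ₂(t) = π Γ(t) Γ(t−1)` = ★ `hermTwoGamma`).
References: [Shimura1982, (1.16)/(1.31), Case II, m = 2] (derived, not cited).
HONEST LABEL: HC_CM is proved only modulo the 7 printed citations (2 remaining named inputs: hLiu418 = stmt-HodgeConjecture-24832,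
h413 = stmt-HodgeConjecture-24833) until rung 0 closes; count-neutral helper, closes no socket.
-/

set_option autoImplicit false
set_option linter.dupNamespace false

noncomputable section

open Complex MeasureTheory Set Matrix
open scoped ComplexOrder ComplexConjugate

namespace Summit.HodgeConjecture.HodgeConjecture.Cruxes.HLiu418.K2LiuArchIntertwiningScalarValue

open Summit.HodgeConjecture.HodgeConjecture.Cruxes.HLiu418.K2LiuHermTwoGammaDefs
open Summit.HodgeConjecture.HodgeConjecture.Cruxes.HLiu418.K2LiuHermTwoConfluentXiDefs
open Summit.HodgeConjecture.HodgeConjecture.Cruxes.HLiu418.K2LiuHermTwoXiZeroValue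
open Summit.HodgeConjecture.HodgeConjecture.Cruxes.HLiu418.K2LiuArchInducedTubeDefs
open Summit.HodgeConjecture.HodgeConjecture.Cruxes.HLiu418.K2LiuArchInducedTubeSection

/-! ## §1  The integrands agree pointwise -/

/-- `det(1 − iX) = (1 + |z|² − ab) − (a + b) i` for `X = hermTwo (a, z, b)`. [folklore] -/
theorem det_one_sub_I_smul_hermTwo (c : ℝ × ℂ × ℝ) :
    ((1 : Matrix (Fin 2) (Fin 2) ℂ) - I • hermTwo c).det =
      ((1 + normSq c.2.1 - c.1 * c.2.2 : ℝ) : ℂ) - ((c.1 + c.2.2 : ℝ) : ℂ) * I := by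
  rw [det_sub_I_smul_hermTwo, Matrix.one_apply_eq, Matrix.one_apply_eq, Matrix.one_apply_ne (show (0 : Fin 2) ≠ 1 by decide),
    Matrix.one_apply_ne (show (1 : Fin 2) ≠ 0 by decide)]
  apply Complex.ext
  · simp [Complex.normSq_apply]
    ring
  · simp
    ring

/-- Real part of `det(1 − iX)`. [folklore] -/
theorem det_one_sub_I_smul_hermTwo_re (c : ℝ × ℂ × ℝ) :
    (((1 : Matrix (Fin 2) (Fin 2) ℂ) - I • hermTwo c).det).re = 1 + normSq c.2.1 - c.1 * c.2.2 := by
  rw [det_one_sub_I_smul_hermTwo]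
  simp

/-- Imaginary part of `det(1 − iX)`. [folklore] -/
theorem det_one_sub_I_smul_hermTwo_im (c : ℝ × ℂ × ℝ) :
    (((1 : Matrix (Fin 2) (Fin 2) ℂ) - I • hermTwo c).det).im = -(c.1 + c.2.2) := by
  rw [det_one_sub_I_smul_hermTwo]
  simp

/-- `det(1 − iX)` lies in the slit plane `ℂ ∖ (−∞, 0]` for Hermitian `X` (if its imaginary part `−(a+b)` vanishes, its real part is
`1 + |z|² + a² > 0`). [folklore] -/
theorem det_one_sub_I_smul_hermTwo_mem_slitPlane (c : ℝ × ℂ × ℝ) :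
    ((1 : Matrix (Fin 2) (Fin 2) ℂ) - I • hermTwo c).det ∈ slitPlane := by
  rw [mem_slitPlane_iff, det_one_sub_I_smul_hermTwo_re, det_one_sub_I_smul_hermTwo_im]
  by_cases h : c.1 + c.2.2 = 0
  · left
    have hb : c.2.2 = -c.1 := by linarith
    rw [hb]
    nlinarith [normSq_nonneg c.2.1, sq_nonneg c.1]
  · right
    rwa [ne_eq, neg_eq_zero]

/-- `det(1 + iX) = conj det(1 − iX)` for Hermitian `X = hermTwo c`. [folklore] -/
theorem det_one_add_I_smul_hermTwo (c : ℝ × ℂ × ℝ) :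
    ((1 : Matrix (Fin 2) (Fin 2) ℂ) + I • hermTwo c).det = conj (((1 : Matrix (Fin 2) (Fin 2) ℂ) - I • hermTwo c).det) := by
  have h : (1 : Matrix (Fin 2) (Fin 2) ℂ) + I • hermTwo c = ((1 : Matrix (Fin 2) (Fin 2) ℂ) - I • hermTwo c)ᴴ := by
    rw [conjTranspose_sub, conjTranspose_one, conjTranspose_smul, (isHermitian_hermTwo c).eq, Complex.star_def, conj_I, neg_smul,
      sub_neg_eq_add]
  rw [h, det_conjTranspose, Complex.star_def]

/-- `X + i·1 = i · (1 − iX)`, hence `det(X + i) = −det(1 − iX)` (`2 × 2`). [folklore] -/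
theorem det_hermTwo_add_I_smul_one (c : ℝ × ℂ × ℝ) :
    (hermTwo c + I • (1 : Matrix (Fin 2) (Fin 2) ℂ)).det = -((1 : Matrix (Fin 2) (Fin 2) ℂ) - I • hermTwo c).det := by
  have h : hermTwo c + I • (1 : Matrix (Fin 2) (Fin 2) ℂ) = I • ((1 : Matrix (Fin 2) (Fin 2) ℂ) - I • hermTwo c) := by
    rw [smul_sub, smul_smul, I_mul_I, neg_one_smul, sub_neg_eq_add, add_comm]
  rw [h, det_smul, Fintype.card_fin, I_sq, neg_one_mul]

/-- **THE INTEGRANDS AGREE**: for `X = hermTwo c`, `k : ℤ`, `s : ℂ`,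
`det(X+i)^{−k} · |det(X+i)|^{k−2s−2} = xiTwoIntegrand 1 0 (s+1+k/2) (s+1−k/2) c`
(Shimura's branches `det(x+i)^{−α} := e^{−iπα} det(1−ix)^{−α}`, `det(x−i)^{−β} := e^{iπβ} det(1+ix)^{−β}`, principal powers). [Shimura1982, (1.25)] -/
theorem integrand_eq (k : ℤ) (s : ℂ) (c : ℝ × ℂ × ℝ) :
    (hermTwo c + I • (1 : Matrix (Fin 2) (Fin 2) ℂ)).det ^ (-k) *
        (((‖(hermTwo c + I • (1 : Matrix (Fin 2) (Fin 2) ℂ)).det‖ : ℝ) : ℂ) ^ ((k : ℂ) - 2 * s - 2)) =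
      xiTwoIntegrand 1 0 (s + 1 + k / 2) (s + 1 - k / 2) c := by
  set D : ℂ := ((1 : Matrix (Fin 2) (Fin 2) ℂ) - I • hermTwo c).det with hD
  have hDs : D ∈ slitPlane := det_one_sub_I_smul_hermTwo_mem_slitPlane c
  have hD0 : D ≠ 0 := (mem_slitPlane_iff_arg.mp hDs).2
  have hDπ : D.arg ≠ Real.pi := (mem_slitPlane_iff_arg.mp hDs).1
  have hn0 : ((‖D‖ : ℝ) : ℂ) ≠ 0 := by exact_mod_cast (norm_pos_iff.mpr hD0).ne'
  rw [xiTwoIntegrand_apply, det_hermTwo_add_I_smul_one, det_one_add_I_smul_hermTwo, ← hD, norm_neg, Matrix.zero_mul,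
    Matrix.trace_zero, mul_zero, Complex.exp_zero, one_mul]
  -- every factor as an exponential
  have e1 : (-D) ^ (-k) = cexp ((((-k : ℤ)) : ℂ) * (Real.pi * I)) * cexp (Complex.log D * (((-k : ℤ)) : ℂ)) := by
    rw [Complex.exp_int_mul, Complex.exp_pi_mul_I, ← Complex.cpow_def_of_ne_zero hD0, Complex.cpow_intCast, neg_eq_neg_one_mul,
      mul_zpow]
  have e2 : (((‖D‖ : ℝ) : ℂ)) ^ ((k : ℂ) - 2 * s - 2) = cexp (((Complex.log D).re : ℂ) * ((k : ℂ) - 2 * s - 2)) := by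
    rw [Complex.cpow_def_of_ne_zero hn0, (Complex.ofReal_log (norm_nonneg D)).symm, Complex.log_re]
  have e3 : D ^ (-(s + 1 + k / 2)) = cexp (Complex.log D * (-(s + 1 + k / 2))) := Complex.cpow_def_of_ne_zero hD0 _
  have e4 : (conj D) ^ (-(s + 1 - k / 2)) = cexp (conj (Complex.log D) * (-(s + 1 - k / 2))) := by
    rw [Complex.cpow_def_of_ne_zero ((map_ne_zero _).mpr hD0), Complex.log_conj_eq_ite, if_neg hDπ]
  rw [e1, e2, e3, e4]
  simp only [← Complex.exp_add, mul_assoc]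
  congr 1
  -- the exponents agree: write `log D = u + v i`
  obtain ⟨u, hu⟩ : ∃ u : ℝ, (Complex.log D).re = u := ⟨_, rfl⟩
  obtain ⟨v, hv⟩ : ∃ v : ℝ, (Complex.log D).im = v := ⟨_, rfl⟩
  have hL : Complex.log D = (u : ℂ) + (v : ℂ) * I := by
    rw [← hu, ← hv]
    exact (Complex.re_add_im _).symm
  have hLc : conj (Complex.log D) = (u : ℂ) - (v : ℂ) * I := by
    rw [hL, map_add, map_mul, Complex.conj_ofReal, Complex.conj_ofReal, Complex.conj_I]
    ring
  rw [hLc, hu, hL]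
  push_cast
  ring

/-! ## §2  The Jacobian constant: `hermOfReal` versus `hermTwo` coordinates -/

/-- A VOLUME-PRESERVING RESHUFFLE `r ↦ (r₀₀, ⟨r₀₁, r₁₀⟩, r₁₁)` of `Fin 2 → Fin 2 → ℝ` onto `ℝ × ℂ × ℝ` (as a measurable equivalence;
built from `piFinTwo`, `finTwoArrow`, `prodAssoc` and `Complex.measurableEquivRealProd`, all volume preserving). [folklore] -/
theorem exists_shuffle : ∃ e : (Fin 2 → Fin 2 → ℝ) ≃ᵐ ℝ × ℂ × ℝ,
    MeasurePreserving e volume volume ∧ ∀ r, e r = (r 0 0, (⟨r 0 1, r 1 0⟩ : ℂ), r 1 1) := by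
  have h1 : MeasurePreserving (MeasurableEquiv.piFinTwo fun _ : Fin 2 => Fin 2 → ℝ) volume volume :=
    volume_preserving_piFinTwo fun _ : Fin 2 => Fin 2 → ℝ
  have h2 : MeasurePreserving (MeasurableEquiv.prodCongr (MeasurableEquiv.finTwoArrow (α := ℝ)) (MeasurableEquiv.finTwoArrow (α := ℝ)))
      (volume : Measure ((Fin 2 → ℝ) × (Fin 2 → ℝ))) volume :=
    (volume_preserving_finTwoArrow ℝ).prod (volume_preserving_finTwoArrow ℝ)
  have hA : ∀ {α β γ : Type} [MeasureSpace α] [MeasureSpace β] [MeasureSpace γ] [SFinite (volume : Measure α)]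
      [SFinite (volume : Measure β)] [SFinite (volume : Measure γ)],
      MeasurePreserving (MeasurableEquiv.prodAssoc : (α × β) × γ ≃ᵐ α × β × γ) volume volume :=
    fun {α β γ} _ _ _ _ _ _ => ⟨MeasurableEquiv.prodAssoc.measurable, Measure.prodAssoc_prod⟩
  have h4 : MeasurePreserving (MeasurableEquiv.prodCongr measurableEquivRealProd.symm (MeasurableEquiv.refl ℝ))
      (volume : Measure ((ℝ × ℝ) × ℝ)) volume :=
    volume_preserving_equiv_real_prod.symm.prod (MeasurePreserving.id volume)
  have h5 : MeasurePreserving (MeasurableEquiv.prodAssoc.symm.trans (MeasurableEquiv.prodCongr measurableEquivRealProd.symm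
      (MeasurableEquiv.refl ℝ))) (volume : Measure (ℝ × ℝ × ℝ)) volume :=
    h4.comp hA.symm
  have h6 : MeasurePreserving (MeasurableEquiv.prodCongr (MeasurableEquiv.refl ℝ) (MeasurableEquiv.prodAssoc.symm.trans
      (MeasurableEquiv.prodCongr measurableEquivRealProd.symm (MeasurableEquiv.refl ℝ)))) (volume : Measure (ℝ × (ℝ × ℝ × ℝ))) volume :=
    (MeasurePreserving.id volume).prod h5
  exact ⟨((MeasurableEquiv.piFinTwo fun _ : Fin 2 => Fin 2 → ℝ).trans
      (MeasurableEquiv.prodCongr MeasurableEquiv.finTwoArrow MeasurableEquiv.finTwoArrow)).trans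
      (MeasurableEquiv.prodAssoc.trans (MeasurableEquiv.prodCongr (MeasurableEquiv.refl ℝ)
        (MeasurableEquiv.prodAssoc.symm.trans (MeasurableEquiv.prodCongr measurableEquivRealProd.symm (MeasurableEquiv.refl ℝ))))),
    (h6.comp hA).comp (h2.comp h1), fun r => rfl⟩

/-- THE LINEAR STRETCH `(a, z, b) ↦ (2a, (re z + im z) + (re z − im z) i, 2b)` of `ℝ × ℂ × ℝ` has determinant `−8`
(`2 · det [[1, 1], [1, −1]] · 2`, the middle block in the basis `(1, i)`). [folklore] -/
theorem exists_stretch : ∃ T : (ℝ × ℂ × ℝ) →ₗ[ℝ] (ℝ × ℂ × ℝ), LinearMap.det T = -8 ∧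
    ∀ c, T c = (2 * c.1, ((c.2.1.re + c.2.1.im : ℝ) : ℂ) + ((c.2.1.re - c.2.1.im : ℝ) : ℂ) * I, 2 * c.2.2) := by
  -- the middle block
  obtain ⟨S, hS⟩ : ∃ S : ℂ →ₗ[ℝ] ℂ, S = Complex.reLm.smulRight (1 + I) + Complex.imLm.smulRight (1 - I) := ⟨_, rfl⟩
  have hSapp : ∀ z : ℂ, S z = ((z.re + z.im : ℝ) : ℂ) + ((z.re - z.im : ℝ) : ℂ) * I := by
    intro z
    simp only [hS, LinearMap.add_apply, LinearMap.smulRight_apply, Complex.reLm_coe, Complex.imLm_coe, Complex.real_smul]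
    push_cast
    ring
  have hSdet : LinearMap.det S = -2 := by
    have hM : LinearMap.toMatrix basisOneI basisOneI S = !![1, 1; 1, -1] := by
      ext i j
      fin_cases i <;> fin_cases j <;> simp [LinearMap.toMatrix_apply, hS]
    rw [← LinearMap.det_toMatrix basisOneI, hM, Matrix.det_fin_two_of]
    norm_num
  have h2 : LinearMap.det ((2 : ℝ) • (LinearMap.id : ℝ →ₗ[ℝ] ℝ)) = 2 := by
    rw [LinearMap.det_smul, LinearMap.det_id, Module.finrank_self]
    norm_num
  refine ⟨((2 : ℝ) • LinearMap.id).prodMap (S.prodMap ((2 : ℝ) • LinearMap.id)), ?_, fun c => ?_⟩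
  · rw [LinearMap.det_prodMap, LinearMap.det_prodMap, h2, hSdet]
    norm_num
  · simp [LinearMap.prodMap_apply, hSapp]

/-- `hermOfReal r = hermTwo (2 r₀₀, (r₀₁ + r₁₀) + (r₀₁ − r₁₀) i, 2 r₁₁)`. [folklore] -/
theorem hermOfReal_eq_hermTwo (r : Fin 2 → Fin 2 → ℝ) :
    hermOfReal r = hermTwo (2 * r 0 0, ((r 0 1 + r 1 0 : ℝ) : ℂ) + ((r 0 1 - r 1 0 : ℝ) : ℂ) * I, 2 * r 1 1) := by
  ext i j
  fin_cases i <;> fin_cases j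
  · simp only [hermOfReal_apply, Fin.zero_eta, hermTwo_apply_zero_zero, sub_self]
    push_cast
    ring
  · simp only [hermOfReal_apply, Fin.zero_eta, Fin.mk_one, hermTwo_apply_zero_one]
  · simp only [hermOfReal_apply, Fin.zero_eta, Fin.mk_one, hermTwo_apply_one_zero, map_add, map_mul, Complex.conj_ofReal,
      Complex.conj_I]
    push_cast
    ring
  · simp only [hermOfReal_apply, Fin.mk_one, hermTwo_apply_one_one, sub_self]
    push_cast
    ring

/-- **THE JACOBIAN CONSTANT**: for every `F`, `∫_{r : Fin 2 → Fin 2 → ℝ} F(hermOfReal r) dr = (1/8) · ∫_{c : ℝ × ℂ × ℝ} F(hermTwo c) dc`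
(both Lebesgue; no integrability hypothesis — the two Bochner integrals vanish together). [folklore] -/
theorem integral_hermOfReal_eq (F : Matrix (Fin 2) (Fin 2) ℂ → ℂ) :
    ∫ r : Fin 2 → Fin 2 → ℝ, F (hermOfReal r) = (1 / 8 : ℂ) * ∫ c : ℝ × ℂ × ℝ, F (hermTwo c) := by
  obtain ⟨e₀, he₀, he₀r⟩ := exists_shuffle
  obtain ⟨T, hTdet, hT⟩ := exists_stretch
  have hdet : LinearMap.det T ≠ 0 := by
    rw [hTdet]
    norm_num
  haveI hC : ((volume : Measure ℂ).prod (volume : Measure ℝ)).IsAddHaarMeasure := Measure.prod.instIsAddHaarMeasure _ _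
  haveI : (volume : Measure (ℝ × ℂ × ℝ)).IsAddHaarMeasure := by
    rw [show (volume : Measure (ℝ × ℂ × ℝ)) = (volume : Measure ℝ).prod ((volume : Measure ℂ).prod (volume : Measure ℝ)) from rfl]
    exact Measure.prod.instIsAddHaarMeasure _ _
  -- the reshuffle: `hermOfReal r = hermTwo (T (e₀ r))`
  have hcomp : ∀ r : Fin 2 → Fin 2 → ℝ, hermOfReal r = hermTwo (T (e₀ r)) := by
    intro r
    rw [hermOfReal_eq_hermTwo, he₀r, hT]
  have h1 : ∫ r : Fin 2 → Fin 2 → ℝ, F (hermOfReal r) = ∫ c : ℝ × ℂ × ℝ, F (hermTwo (T c)) := by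
    simp only [hcomp]
    exact he₀.integral_comp' (f := e₀) (fun c => F (hermTwo (T c)))
  -- the linear stretch
  let e : (ℝ × ℂ × ℝ) ≃L[ℝ] (ℝ × ℂ × ℝ) := (LinearMap.equivOfDetNeZero T hdet).toContinuousLinearEquiv
  have he : (e : (ℝ × ℂ × ℝ) → (ℝ × ℂ × ℝ)) = T := rfl
  have hemb : MeasurableEmbedding T := by
    rw [← he]
    exact e.toHomeomorph.toMeasurableEquiv.measurableEmbedding
  have h2 : ∫ c : ℝ × ℂ × ℝ, F (hermTwo c) ∂(Measure.map T volume) = ∫ c : ℝ × ℂ × ℝ, F (hermTwo (T c)) :=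
    hemb.integral_map (μ := volume) (fun c : ℝ × ℂ × ℝ => F (hermTwo c))
  rw [h1, ← h2, Measure.map_linearMap_addHaar_eq_smul_addHaar _ hdet, integral_smul_measure, hTdet, Complex.real_smul]
  congr 1
  norm_num [ENNReal.toReal_ofReal]

/-! ## §3  The value of the scalar intertwining integral -/

/-- **JUNCTION**: `M_w(s) f⁰_{s,k}(1) = (1/8) · ξ(1, 0; s+1+k/2, s+1−k/2)` (all `k : ℤ`, `s : ℂ`; both sides are Bochner integrals with the
same convergence). [Shimura1982, (1.25)] -/
theorem archIntertwining_archScalarSection_one_eq_xiTwo (k : ℤ) (s : ℂ) :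
    archIntertwining (archScalarSection k s) (1 : Matrix (Fin 2 ⊕ Fin 2) (Fin 2 ⊕ Fin 2) ℂ) =
      (1 / 8 : ℂ) * xiTwo 1 0 (s + 1 + k / 2) (s + 1 - k / 2) := by
  rw [archIntertwining_archScalarSection_one, Fintype.card_fin, Nat.cast_ofNat, xiTwo_def,
    integral_hermOfReal_eq (fun X => (X + I • (1 : Matrix (Fin 2) (Fin 2) ℂ)).det ^ (-k) *
      (((‖(X + I • (1 : Matrix (Fin 2) (Fin 2) ℂ)).det‖ : ℝ) : ℂ) ^ ((k : ℂ) - 2 * s - 2)))]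
  congr 1
  exact integral_congr_ae (Filter.Eventually.of_forall fun c => integrand_eq k s c)

/-- **THE VALUE** (the (A∞-B) face of the A∞ organ): for `k : ℤ` and `re s > ½` (the half-plane of absolute convergence),
`M_w(s) f⁰_{s,k}(1) = (1/8) · 4π⁴ · e^{−iπk} · Γ₂(s+1+k/2)⁻¹ · Γ₂(s+1−k/2)⁻¹ · (Γ₂(2s) · 4^{−2s})`, `Γ₂ = hermTwoGamma`.
The right-hand side is meromorphic in `s` on all of `ℂ`; its value/zero/pole at any `s` (e.g. `s = ½`, where `Γ₂(2s) = πΓ(2s)Γ(2s−1)` has a simple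
pole and `Γ₂(s+1−k/2)⁻¹` a zero of order `0, 1, 2` according to `k`) is read off directly. [Shimura1982, (1.16)/(1.31), Case II, m = 2] -/
theorem archIntertwining_archScalarSection_one_eq (k : ℤ) {s : ℂ} (hs : 1 / 2 < s.re) :
    archIntertwining (archScalarSection k s) (1 : Matrix (Fin 2 ⊕ Fin 2) (Fin 2 ⊕ Fin 2) ℂ) =
      (1 / 8 : ℂ) * (((4 * Real.pi ^ 4 : ℝ) : ℂ) * cexp (-(Real.pi * I) * k) * (hermTwoGamma (s + 1 + k / 2))⁻¹ *
        (hermTwoGamma (s + 1 - k / 2))⁻¹ * (hermTwoGamma (2 * s) * (4 : ℂ) ^ (-(2 * s)))) := by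
  have hαβ : 3 < ((s + 1 + k / 2) + (s + 1 - k / 2)).re := by
    have : ((s + 1 + k / 2) + (s + 1 - k / 2) : ℂ) = 2 * s + 2 := by ring
    rw [this, Complex.add_re, Complex.mul_re]
    norm_num
    linarith
  have hdet : ((2 : ℂ) • (1 : Matrix (Fin 2) (Fin 2) ℂ)).det = 4 := by
    rw [det_smul, det_one, mul_one, Fintype.card_fin]
    norm_num
  rw [archIntertwining_archScalarSection_one_eq_xiTwo, xiTwo_zero_right Matrix.PosDef.one hαβ, hdet]
  have e1 : (Real.pi * I) * ((s + 1 - k / 2) - (s + 1 + k / 2)) = -(Real.pi * I) * k := by ring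
  have e2 : ((s + 1 + k / 2) + (s + 1 - k / 2) - 2 : ℂ) = 2 * s := by ring
  rw [e1, e2]

end Summit.HodgeConjecture.HodgeConjecture.Cruxes.HLiu418.K2LiuArchIntertwiningScalarValue

end
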